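import Literature.Computability.Cryptography.PeriodFindingCosetWindow
import Literature.Computability.Cryptography.PeriodFindingCosetBoxCount
import HarnessLib

/-!
# Class sums of a digit register: Parseval, digits, and the window energy in register form

Topic `Computability/Cryptography` (harmonic analysis of period finding over `ℤ^T`); theorem-only file, no named facts.
Sequel of `PeriodFindingCosetWindow.lean` (window energy of the box character sum of ONE coset, box form).

The register `[0, M^T)` is read through its base-`M` digit vectors `d(E) = (E / M^t mod M)_t ∈ [0,M)^T`; a labelling
`cls` of the register with `cls E = cls E' ↔ d(E) − d(E') ∈ Λ` is a class table of the finite-index subgroup `Λ ≤ ℤ^T`.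
Fourier sampling the register at the frequency `ν < M^T` with base angles `x` gives digit `t` the angle
`x_t + ν/M^{T−t}`, i.e. the character `e(θ_ν · d(E)) = e(x · d(E)) · e(ν E / M^T)` (`eR_digits_shift`). This file moves
between the register and the box:

* `sum_norm_sq_sum_mul_chr` — Parseval on `ℤ/M^T`; `sum_norm_sq_classSum` — the total energy over `ν` of a weighted class
  sum `∑_{E ∈ A} e(θ_ν·d(E)) ψ(E)` is `M^T ∑_{E∈A} |ψ(E)|²` exactly, for ALL base angles;
* `sum_class_eq_sum_coset` — a class of the register is a coset of `Λ` met with the box (reindexing by the digits);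
* `class_window_energy_ge` — `coset_window_energy_ge` in register form: for every class, every character `χ₀` (angles
  `η₀`) and all base angles, the energy in the window of `χ₀` is `≥ (M^{2T}/h²)(1 − T/(u−2) − 2h²(2u)^T/M)`;
* `sum_norm_sq_le_add_of_perturb`, `classSum_unperturbed_le` — an `ℓ²` perturbation lemma: multiplying the terms of the
  class sum by unimodular-ish weights `ψ(E)` with `|ψ(E) − 1| ≤ ε` costs at most `2 M^T #A ε` of window energy
  (Cauchy–Schwarz against the exact total energies).

## References

* S. Hallgren, STOC 2005, §4. [Hallgren2005]
* A. Yu. Kitaev, arXiv:quant-ph/9511026 (1995), §4. [Kitaev1995]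
-/

noncomputable section

namespace Literature.Computability.Cryptography

namespace PeriodFinding

open Complex Finset

variable {T : ℕ}

/-! ### Parseval on `ℤ/W` -/

/-- **Parseval on `ℤ/W`**: `∑_{ν<W} |∑_{E<W} b(E) e(νE/W)|² = W ∑_{E<W} |b(E)|²`. [folklore] -/
theorem sum_norm_sq_sum_mul_chr (W : ℕ) (hW : 0 < W) (b : ℕ → ℂ) :
    ∑ ν ∈ range W, ‖∑ E ∈ range W, b E * chr W ν E‖ ^ 2 = W * ∑ E ∈ range W, ‖b E‖ ^ 2 := by
  apply Complex.ofReal_injective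
  push_cast
  have hexp : ∀ ν ∈ range W, (((‖∑ E ∈ range W, b E * chr W ν E‖ : ℝ) : ℂ) ^ 2) =
      ∑ E ∈ range W, ∑ E' ∈ range W, b E * (starRingEnd ℂ) (b E') * chr W ν ((E : ℤ) - E') := by
    intro ν _
    rw [cast_norm_sq_sum]
    refine sum_congr rfl fun E _ => sum_congr rfl fun E' _ => ?_
    rw [map_mul, conj_chr, show ((E : ℤ) - E') = E + -(E' : ℤ) by ring, chr_add]
    ring
  rw [sum_congr rfl hexp, sum_comm]
  have hinner : ∀ E ∈ range W, (∑ ν ∈ range W, ∑ E' ∈ range W,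
      b E * (starRingEnd ℂ) (b E') * chr W ν ((E : ℤ) - E')) = W * (b E * (starRingEnd ℂ) (b E)) := by
    intro E hE
    rw [sum_comm]
    have : ∀ E' ∈ range W, (∑ ν ∈ range W, b E * (starRingEnd ℂ) (b E') * chr W ν ((E : ℤ) - E')) =
        if E' = E then (W : ℂ) * (b E * (starRingEnd ℂ) (b E)) else 0 := by
      intro E' hE'
      rw [← mul_sum, sum_chr W hW]
      by_cases h : E' = E
      · subst h; simp [mul_comm]
      · rw [if_neg (fun hd => h ((dvd_sub_iff_eq (mem_range.1 hE) (mem_range.1 hE')).1 hd)), if_neg h, mul_zero]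
    rw [sum_congr rfl this, sum_ite_eq' (range W) E, if_pos hE]
  rw [sum_congr rfl hinner, mul_sum]
  refine sum_congr rfl fun E _ => ?_
  rw [Complex.mul_conj']

/-! ### Digits of the register -/

/-- The number with box digits `e` is below `M^T`. [folklore] -/
theorem ofDigits_lt {M : ℕ} (e : Fin T → ℕ) (he : e ∈ boxT T M) : ∑ t : Fin T, e t * M ^ (t : ℕ) < M ^ T := by
  have h := (finFunctionFinEquiv (fun t => (⟨e t, mem_range.1 (Fintype.mem_piFinset.1 he t)⟩ : Fin M))).isLt
  rwa [finFunctionFinEquiv_apply] at h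

/-- The digits of the number with box digits `e` are `e`. [folklore] -/
theorem ofDigits_div_pow_mod {M : ℕ} (e : Fin T → ℕ) (he : e ∈ boxT T M) (s : Fin T) :
    (∑ t : Fin T, e t * M ^ (t : ℕ)) / M ^ (s : ℕ) % M = e s := by
  have h := finFunctionFinEquiv_div_pow_mod (fun t => (⟨e t, mem_range.1 (Fintype.mem_piFinset.1 he t)⟩ : Fin M)) s
  rwa [finFunctionFinEquiv_apply] at h

/-- **Digit expansion**: `E = ∑_t (E / M^t mod M) M^t` for `E < M^T`. [folklore] -/
theorem sum_digit_mul_pow {M E : ℕ} (hE : E < M ^ T) : ∑ t : Fin T, (E / M ^ (t : ℕ) % M) * M ^ (t : ℕ) = E := by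
  have h := finFunctionFinEquiv_apply ((finFunctionFinEquiv : (Fin T → Fin M) ≃ Fin (M ^ T)).symm ⟨E, hE⟩)
  simp only [Equiv.apply_symm_apply, finFunctionFinEquiv_symm_apply_val] at h
  exact h.symm

/-- The digit vector of any `E` lies in the box (for `0 < M`). [folklore] -/
theorem digits_mem_boxT {M : ℕ} (hM : 0 < M) (E : ℕ) : (fun t : Fin T => E / M ^ (t : ℕ) % M) ∈ boxT T M :=
  Fintype.mem_piFinset.2 fun _ => mem_range.2 (Nat.mod_lt _ hM)

/-- Character values `e(θ·v)` have norm one. [folklore] -/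
theorem norm_eR (θ : Fin T → ℝ) (v : Fin T → ℤ) : ‖eR θ v‖ = 1 := by
  unfold eR
  rw [show 2 * (Real.pi : ℂ) * I * ((∑ i, θ i * (v i : ℝ) : ℝ) : ℂ) = ((2 * Real.pi * ∑ i, θ i * (v i : ℝ) : ℝ) : ℂ) * I by
    push_cast; ring]
  exact Complex.norm_exp_ofReal_mul_I _

/-- `eR` is a character in the frequency too: `e((θ + θ')·v) = e(θ·v) e(θ'·v)`. [folklore] -/
theorem eR_add_left (θ θ' : Fin T → ℝ) (v : Fin T → ℤ) : eR (fun t => θ t + θ' t) v = eR θ v * eR θ' v := by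
  unfold eR
  rw [← Complex.exp_add]
  congr 1
  rw [show (∑ i, (θ i + θ' i) * (v i : ℝ) : ℝ) = (∑ i, θ i * (v i : ℝ)) + ∑ i, θ' i * (v i : ℝ) by
    rw [← sum_add_distrib]; exact sum_congr rfl fun i _ => by ring]
  push_cast
  ring

/-- **Shifting the base angles by `c/M^{T−t}` multiplies the character of the digit vector by `e(cE/M^T)`**:
the lower digits of a frequency only tilt the angles. [folklore] -/
theorem eR_digits_shift {M : ℕ} (hM : 0 < M) (x : Fin T → ℝ) (c : ℝ) {E : ℕ} (hE : E < M ^ T) :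
    eR (fun t => x t + c / (M : ℝ) ^ (T - (t : ℕ))) (toZ fun t : Fin T => E / M ^ (t : ℕ) % M) =
      eR x (toZ fun t : Fin T => E / M ^ (t : ℕ) % M) * cexp (2 * Real.pi * I * ((c * E / (M : ℝ) ^ T : ℝ) : ℂ)) := by
  have hMR : (M : ℝ) ≠ 0 := by exact_mod_cast hM.ne'
  unfold eR toZ
  simp only [Int.cast_natCast]
  rw [← Complex.exp_add]
  congr 1
  have hdig : (E : ℝ) = ∑ t : Fin T, ((E / M ^ (t : ℕ) % M : ℕ) : ℝ) * (M : ℝ) ^ (t : ℕ) := by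
    exact_mod_cast (sum_digit_mul_pow hE).symm
  have hterm : ∀ i : Fin T, c / (M : ℝ) ^ (T - (i : ℕ)) * ((E / M ^ (i : ℕ) % M : ℕ) : ℝ) =
      c * (((E / M ^ (i : ℕ) % M : ℕ) : ℝ) * (M : ℝ) ^ (i : ℕ)) / (M : ℝ) ^ T := by
    intro i
    have hpow : (M : ℝ) ^ (T - (i : ℕ)) * (M : ℝ) ^ (i : ℕ) = (M : ℝ) ^ T := by
      rw [← pow_add, Nat.sub_add_cancel i.isLt.le]
    rw [← hpow]
    field_simp
  have key : (∑ i : Fin T, (x i + c / (M : ℝ) ^ (T - (i : ℕ))) * ((E / M ^ (i : ℕ) % M : ℕ) : ℝ) : ℝ) =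
      (∑ i : Fin T, x i * ((E / M ^ (i : ℕ) % M : ℕ) : ℝ)) + c * E / (M : ℝ) ^ T := by
    rw [hdig, mul_sum, sum_div, ← sum_add_distrib]
    refine sum_congr rfl fun i _ => ?_
    rw [add_mul, hterm i]
  rw [key]
  push_cast
  ring

/-- The case `c = ν ∈ ℕ`: `e(θ_ν·d(E)) = e(x·d(E)) · chr_{M^T}(ν E)`. [folklore] -/
theorem eR_digits_shift_nat {M : ℕ} (hM : 0 < M) (x : Fin T → ℝ) (ν : ℕ) {E : ℕ} (hE : E < M ^ T) :
    eR (fun t => x t + (ν : ℝ) / (M : ℝ) ^ (T - (t : ℕ))) (toZ fun t : Fin T => E / M ^ (t : ℕ) % M) =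
      eR x (toZ fun t : Fin T => E / M ^ (t : ℕ) % M) * chr (M ^ T) ν E := by
  rw [eR_digits_shift hM x ν hE, chr_def]
  congr 2
  push_cast
  ring

/-! ### Total energy of weighted class sums -/

/-- **Total energy of a weighted class sum** (Parseval): for `A ⊆ [0, M^T)`, weights `ψ` and ANY base angles `x`,
`∑_{ν<M^T} |∑_{E∈A} e(θ_ν·d(E)) ψ(E)|² = M^T ∑_{E∈A} |ψ(E)|²`. [folklore] -/
theorem sum_norm_sq_classSum {M : ℕ} (hM : 0 < M) (x : Fin T → ℝ) (A : Finset ℕ) (hA : A ⊆ range (M ^ T))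
    (ψ : ℕ → ℂ) :
    ∑ ν ∈ range (M ^ T), ‖∑ E ∈ A, eR (fun t => x t + (ν : ℝ) / (M : ℝ) ^ (T - (t : ℕ)))
        (toZ fun t : Fin T => E / M ^ (t : ℕ) % M) * ψ E‖ ^ 2 = (M : ℝ) ^ T * ∑ E ∈ A, ‖ψ E‖ ^ 2 := by
  classical
  set b : ℕ → ℂ := fun E => if E ∈ A then eR x (toZ fun t : Fin T => E / M ^ (t : ℕ) % M) * ψ E else 0 with hb
  have hinner : ∀ ν : ℕ, (∑ E ∈ A, eR (fun t => x t + (ν : ℝ) / (M : ℝ) ^ (T - (t : ℕ)))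
      (toZ fun t : Fin T => E / M ^ (t : ℕ) % M) * ψ E) = ∑ E ∈ range (M ^ T), b E * chr (M ^ T) ν E := by
    intro ν
    rw [← sum_subset hA (f := fun E => b E * chr (M ^ T) ν E)]
    · refine sum_congr rfl fun E hE => ?_
      rw [hb]; dsimp only
      rw [if_pos hE, eR_digits_shift_nat hM x ν (mem_range.1 (hA hE))]
      ring
    · intro E _ hE
      rw [hb]; dsimp only
      rw [if_neg hE, zero_mul]
  simp_rw [hinner]
  rw [sum_norm_sq_sum_mul_chr (M ^ T) (pow_pos hM T) b]
  push_cast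
  congr 1
  rw [← sum_subset hA (f := fun E => ‖b E‖ ^ 2)]
  · refine sum_congr rfl fun E hE => ?_
    rw [hb]; dsimp only
    rw [if_pos hE, norm_mul, norm_eR, one_mul]
  · intro E _ hE
    rw [hb]; dsimp only
    rw [if_neg hE, norm_zero, zero_pow two_ne_zero]

/-! ### Classes of the register are cosets met with the box -/

/-- **A class of the register is a coset of `Λ` met with the box**: summing a function of the digit vector over the
class of `E₀` is summing it over the box points of the coset of `d(E₀)`. [folklore] -/
theorem sum_class_eq_sum_coset {β : Type*} [AddCommMonoid β] {M : ℕ} (hM : 0 < M) (Λ : AddSubgroup (Fin T → ℤ))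
    [DecidableEq ((Fin T → ℤ) ⧸ Λ)] (cls : ℕ → ℕ)
    (hcls : ∀ E < M ^ T, ∀ E' < M ^ T, cls E = cls E' ↔
      (fun t : Fin T => ((E / M ^ (t : ℕ) % M : ℕ) : ℤ) - ((E' / M ^ (t : ℕ) % M : ℕ) : ℤ)) ∈ Λ)
    {E₀ : ℕ} (hE₀ : E₀ < M ^ T) (Φ : (Fin T → ℕ) → β) :
    ∑ E ∈ (range (M ^ T)).filter (fun E => cls E = cls E₀), Φ (fun t : Fin T => E / M ^ (t : ℕ) % M) =
      ∑ e ∈ (boxT T M).filter (fun e => (QuotientAddGroup.mk (toZ e) : (Fin T → ℤ) ⧸ Λ) =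
        QuotientAddGroup.mk (toZ fun t : Fin T => E₀ / M ^ (t : ℕ) % M)), Φ e := by
  refine sum_nbij' (fun E => fun t : Fin T => E / M ^ (t : ℕ) % M) (fun e => ∑ t : Fin T, e t * M ^ (t : ℕ))
    ?_ ?_ ?_ ?_ ?_
  · intro E hE
    obtain ⟨hEW, hcl⟩ := mem_filter.1 hE
    refine mem_filter.2 ⟨digits_mem_boxT hM E, ?_⟩
    rw [QuotientAddGroup.eq_iff_sub_mem]
    exact (hcls E (mem_range.1 hEW) E₀ hE₀).1 hcl
  · intro e he
    obtain ⟨hebox, hcl⟩ := mem_filter.1 he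
    have hlt := ofDigits_lt e hebox
    refine mem_filter.2 ⟨mem_range.2 hlt, ?_⟩
    rw [hcls _ hlt E₀ hE₀]
    rw [QuotientAddGroup.eq_iff_sub_mem] at hcl
    convert hcl using 1
    funext t
    simp only [Pi.sub_apply, toZ, ofDigits_div_pow_mod e hebox t]
  · intro E hE
    exact sum_digit_mul_pow (mem_range.1 (mem_filter.1 hE).1)
  · intro e he
    funext t
    exact ofDigits_div_pow_mod e (mem_filter.1 he).1 t
  · intro E _
    rfl

/-! ### The window energy of a class, register form -/

/-- **Window energy of the character sum of one class** (`coset_window_energy_ge` in register form): for a class table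
`cls` of `Λ` on `[0, M^T)`, a class (that of `E₀`), base angles `x`, a character `χ₀` with angles `η₀`, `u ≥ 3` and
`u/M ≤ 1/(4h)`:
`∑_{ν ∈ window(χ₀)} |∑_{cls E = cls E₀} e(θ_ν·d(E))|² ≥ (M^{2T}/h²)(1 − T/(u−2) − 2h²(2u)^T/M)`.
[cite: Hallgren2005, §4] -/
theorem class_window_energy_ge : ∀ {T : ℕ}, 0 < T → ∀ (M : ℕ), 0 < M → ∀ (Λ : AddSubgroup (Fin T → ℤ))
    [Fintype ((Fin T → ℤ) ⧸ Λ)] [DecidableEq ((Fin T → ℤ) ⧸ Λ)] (cls : ℕ → ℕ),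
    (∀ E < M ^ T, ∀ E' < M ^ T, cls E = cls E' ↔
      (fun t : Fin T => ((E / M ^ (t : ℕ) % M : ℕ) : ℤ) - ((E' / M ^ (t : ℕ) % M : ℕ) : ℤ)) ∈ Λ) →
    ∀ {E₀ : ℕ}, E₀ < M ^ T → ∀ (x : Fin T → ℝ) (χ₀ : AddChar ((Fin T → ℤ) ⧸ Λ) ℂ) (η₀ : Fin T → ℝ),
    (∀ t : Fin T, χ₀ (QuotientAddGroup.mk (Pi.single t 1)) = Complex.exp (2 * Real.pi * Complex.I * (η₀ t : ℂ))) →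
    ∀ {u : ℕ}, 3 ≤ u → (u : ℝ) / M ≤ 1 / (4 * Fintype.card ((Fin T → ℤ) ⧸ Λ)) →
    ((M : ℝ) ^ (2 * T) / (Fintype.card ((Fin T → ℤ) ⧸ Λ) : ℝ) ^ 2) *
        (1 - (T : ℝ) / (u - 2) - 2 * (Fintype.card ((Fin T → ℤ) ⧸ Λ) : ℝ) ^ 2 * (2 * u) ^ T / M) ≤
      ∑ ν ∈ (range (M ^ T)).filter (fun ν : ℕ => ∀ t : Fin T, (M : ℝ) *
          min (Int.fract (x t + η₀ t + (ν : ℝ) / (M : ℝ) ^ (T - (t : ℕ))))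
            (1 - Int.fract (x t + η₀ t + (ν : ℝ) / (M : ℝ) ^ (T - (t : ℕ)))) < u),
        ‖∑ E ∈ (range (M ^ T)).filter (fun E => cls E = cls E₀),
            eR (fun t => x t + (ν : ℝ) / (M : ℝ) ^ (T - (t : ℕ))) (toZ fun t : Fin T => E / M ^ (t : ℕ) % M)‖ ^ 2 := by
  intro T hT M hM Λ _ _ cls hcls E₀ hE₀ x χ₀ η₀ hη₀ u hu huM
  have h := coset_window_energy_ge hT M hM Λ (QuotientAddGroup.mk (toZ fun t : Fin T => E₀ / M ^ (t : ℕ) % M))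
    x χ₀ η₀ hη₀ hu huM
  refine h.trans (le_of_eq (sum_congr rfl fun ν _ => ?_))
  rw [sum_class_eq_sum_coset hM Λ cls hcls hE₀
    (fun e => eR (fun t => x t + (ν : ℝ) / (M : ℝ) ^ (T - (t : ℕ))) (toZ e))]

/-! ### The `ℓ²` perturbation lemma -/

/-- **`ℓ²` perturbation on a subset**: `∑_U |f|² ≤ ∑_U |f + g|² + 2 (∑_s |f|²)^{1/2} (∑_s |g|²)^{1/2}` for `U ⊆ s`.
[folklore] -/
theorem sum_norm_sq_le_add_of_perturb (s U : Finset ℕ) (hU : U ⊆ s) (f g : ℕ → ℂ) :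
    ∑ ν ∈ U, ‖f ν‖ ^ 2 ≤ ∑ ν ∈ U, ‖f ν + g ν‖ ^ 2 +
      2 * Real.sqrt (∑ ν ∈ s, ‖f ν‖ ^ 2) * Real.sqrt (∑ ν ∈ s, ‖g ν‖ ^ 2) := by
  have hpt : ∀ ν, ‖f ν‖ ^ 2 - 2 * (‖f ν‖ * ‖g ν‖) ≤ ‖f ν + g ν‖ ^ 2 := fun ν => by
    have := norm_sq_add_ge (f ν) (g ν); linarith
  have hsum : ∑ ν ∈ U, ‖f ν‖ ^ 2 - 2 * ∑ ν ∈ U, ‖f ν‖ * ‖g ν‖ ≤ ∑ ν ∈ U, ‖f ν + g ν‖ ^ 2 := by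
    rw [mul_sum, ← sum_sub_distrib]; exact sum_le_sum fun ν _ => hpt ν
  have hCS : ∑ ν ∈ U, ‖f ν‖ * ‖g ν‖ ≤ Real.sqrt (∑ ν ∈ s, ‖f ν‖ ^ 2) * Real.sqrt (∑ ν ∈ s, ‖g ν‖ ^ 2) := by
    have h1 : ∑ ν ∈ U, ‖f ν‖ * ‖g ν‖ ≤ ∑ ν ∈ s, ‖f ν‖ * ‖g ν‖ :=
      sum_le_sum_of_subset_of_nonneg hU fun ν _ _ => by positivity
    have h2 : (∑ ν ∈ s, ‖f ν‖ * ‖g ν‖) ^ 2 ≤ (∑ ν ∈ s, ‖f ν‖ ^ 2) * ∑ ν ∈ s, ‖g ν‖ ^ 2 :=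
      sum_mul_sq_le_sq_mul_sq _ _ _
    have h3 : ∑ ν ∈ s, ‖f ν‖ * ‖g ν‖ ≤ Real.sqrt ((∑ ν ∈ s, ‖f ν‖ ^ 2) * ∑ ν ∈ s, ‖g ν‖ ^ 2) := by
      rw [← Real.sqrt_sq (sum_nonneg fun ν _ => by positivity : (0 : ℝ) ≤ ∑ ν ∈ s, ‖f ν‖ * ‖g ν‖)]
      exact Real.sqrt_le_sqrt h2
    rw [← Real.sqrt_mul (sum_nonneg fun ν _ => by positivity)]
    exact h1.trans h3
  nlinarith [hsum, hCS]

/-- **Unimodular jitter costs little window energy**: for `A ⊆ [0,M^T)`, weights with `|ψ(E) − 1| ≤ ε`, and any set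
`U` of frequencies, `∑_{ν∈U} |∑_{E∈A} e(θ_ν·d(E))|² ≤ ∑_{ν∈U} |∑_{E∈A} e(θ_ν·d(E)) ψ(E)|² + 2 M^T #A ε`.
[folklore] -/
theorem classSum_unperturbed_le {M : ℕ} (hM : 0 < M) (x : Fin T → ℝ) (A : Finset ℕ) (hA : A ⊆ range (M ^ T))
    (ψ : ℕ → ℂ) {ε : ℝ} (hε : 0 ≤ ε) (hψ : ∀ E ∈ A, ‖ψ E - 1‖ ≤ ε) (U : Finset ℕ) (hU : U ⊆ range (M ^ T)) :
    ∑ ν ∈ U, ‖∑ E ∈ A, eR (fun t => x t + (ν : ℝ) / (M : ℝ) ^ (T - (t : ℕ)))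
        (toZ fun t : Fin T => E / M ^ (t : ℕ) % M)‖ ^ 2 ≤
      ∑ ν ∈ U, ‖∑ E ∈ A, eR (fun t => x t + (ν : ℝ) / (M : ℝ) ^ (T - (t : ℕ)))
        (toZ fun t : Fin T => E / M ^ (t : ℕ) % M) * ψ E‖ ^ 2 + 2 * (M : ℝ) ^ T * A.card * ε := by
  set f : ℕ → ℂ := fun ν => ∑ E ∈ A, eR (fun t => x t + (ν : ℝ) / (M : ℝ) ^ (T - (t : ℕ)))
    (toZ fun t : Fin T => E / M ^ (t : ℕ) % M) * 1 with hf
  set g : ℕ → ℂ := fun ν => ∑ E ∈ A, eR (fun t => x t + (ν : ℝ) / (M : ℝ) ^ (T - (t : ℕ)))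
    (toZ fun t : Fin T => E / M ^ (t : ℕ) % M) * (ψ E - 1) with hg
  have hfg : ∀ ν : ℕ, f ν + g ν = ∑ E ∈ A, eR (fun t => x t + (ν : ℝ) / (M : ℝ) ^ (T - (t : ℕ)))
      (toZ fun t : Fin T => E / M ^ (t : ℕ) % M) * ψ E := by
    intro ν
    simp only [hf, hg, ← sum_add_distrib]
    exact sum_congr rfl fun E _ => by ring
  have hf1 : ∀ ν : ℕ, ∑ E ∈ A, eR (fun t => x t + (ν : ℝ) / (M : ℝ) ^ (T - (t : ℕ)))
      (toZ fun t : Fin T => E / M ^ (t : ℕ) % M) = f ν := fun ν => by simp only [hf, mul_one]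
  have hF : ∑ ν ∈ range (M ^ T), ‖f ν‖ ^ 2 = (M : ℝ) ^ T * A.card := by
    rw [hf, sum_norm_sq_classSum hM x A hA (fun _ => 1)]
    simp
  have hG : ∑ ν ∈ range (M ^ T), ‖g ν‖ ^ 2 ≤ (M : ℝ) ^ T * A.card * ε ^ 2 := by
    rw [hg, sum_norm_sq_classSum hM x A hA (fun E => ψ E - 1), mul_assoc]
    gcongr
    calc ∑ E ∈ A, ‖ψ E - 1‖ ^ 2 ≤ ∑ E ∈ A, ε ^ 2 :=
          sum_le_sum fun E hE => pow_le_pow_left₀ (norm_nonneg _) (hψ E hE) 2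
      _ = A.card * ε ^ 2 := by rw [sum_const, nsmul_eq_mul]
  have hpert := sum_norm_sq_le_add_of_perturb (range (M ^ T)) U hU f g
  simp_rw [hfg] at hpert
  simp_rw [hf1]
  have hsqrt : Real.sqrt (∑ ν ∈ range (M ^ T), ‖f ν‖ ^ 2) * Real.sqrt (∑ ν ∈ range (M ^ T), ‖g ν‖ ^ 2) ≤
      (M : ℝ) ^ T * A.card * ε := by
    rw [hF]
    calc Real.sqrt ((M : ℝ) ^ T * A.card) * Real.sqrt (∑ ν ∈ range (M ^ T), ‖g ν‖ ^ 2)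
        ≤ Real.sqrt ((M : ℝ) ^ T * A.card) * Real.sqrt ((M : ℝ) ^ T * A.card * ε ^ 2) := by
          gcongr
      _ = (M : ℝ) ^ T * A.card * ε := by
          rw [← Real.sqrt_mul (by positivity), show (M : ℝ) ^ T * A.card * ((M : ℝ) ^ T * A.card * ε ^ 2) =
            ((M : ℝ) ^ T * A.card * ε) ^ 2 by ring, Real.sqrt_sq (by positivity)]
  linarith

end PeriodFinding

end Literature.Computability.Cryptography
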